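import Summits.CriticalPhenomena.PercolationContinuityZ3.Theorems.SahiMasterFamilyPhiSymmetricLift
import Summits.CriticalPhenomena.PercolationContinuityZ3.Theorems.SahiMasterFamilyGHConverse
import Summits.CriticalPhenomena.PercolationContinuityZ3.Theorems.SahiMasterFamilyGHSmall

/-!
# `(UC-hull)_k` is MONOTONE in `k` (the orders where it holds form an initial segment)

Unit `prim-masterthm-p4` (gen 16; crux anchor stmt-CriticalPhenomena-4575, helper work; memo
`run/shared/lean/prim/prim-masterthm/prim-masterthm-p4/P4-GEN16-REPORT.md` §6).  Companion of `…GHConjecture` (`UCHullNonneg`), `…GHMonotone`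
(PC-k / (GH)_k monotone), `…GHSmall` (`(UC-hull)_k`, k ≤ 2) and `…PhiSymmetricLift` (branching in `Φ`-form, `phiSet_pullback`:
`Φ_{k+2}(β ∘ pb) = k·Φ_{k+1}(β)` when `β ∅ = 1`).
A mixture `β = Σ_x w_x 1_{𝒰_x}` of union-closed families on `Fin (k+1)` pulls back to the mixture of the union-closed families
`𝒰'_x = {T : pb T ∈ 𝒰_x ∨ pb T = ∅}` on `Fin (k+2)` (`pb T = {i : castSucc i ∈ T}`), whose moment function is `(fixEmpty β) ∘ pb`; `Φ` does not
read the value at `∅` (`GHBridge.phiSet_congr_nonempty`).  Hence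
* **`ucHullNonneg_anti : UCHullNonneg (k+2) → UCHullNonneg (k+1)`** (every `k`) and `ucHullNonneg_of_le : 1 ≤ k → k ≤ k' → UCHullNonneg k' → UCHullNonneg k`.
So a point of the union-closed polytope with `Φ < 0` at one order refutes `(UC-hull)` at all larger orders; with `…UCCertSix`, `(UC-hull)_k` holds for every
`k ≤ 6`.  HONEST FRAMING: monotonicity only; `(UC-hull)_k` OPEN for `k ≥ 7`; Sahi's `C_k` and the master theorem OPEN.  Axioms standard. [this work]
-/

noncomputable section

open scoped Classical

namespace Summit.CriticalPhenomena.PercolationContinuityZ3.Theorems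

namespace PhiCert

open Finset
open Literature.Combinatorics.Sahi2008
open PrincipalCapBeta (phiSet)

variable {k : ℕ}

/-- The pull-back index map `T ↦ {i : castSucc i ∈ T}`. [this work] -/
def pb (T : Finset (Fin (k + 2))) : Finset (Fin (k + 1)) := univ.filter fun i : Fin (k + 1) => Fin.castSucc i ∈ T

/-- The pull-back of `univ` is `univ`. [folklore] -/
theorem pb_univ : pb (univ : Finset (Fin (k + 2))) = univ := by
  ext i; simp [pb]

/-- The pull-back commutes with unions. [folklore] -/
theorem pb_union (S T : Finset (Fin (k + 2))) : pb (S ∪ T) = pb S ∪ pb T := by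
  ext i; simp [pb, mem_union]

/-- Setting the value at `∅` to one. [this work] -/
def fixEmpty (β : Finset (Fin (k + 1)) → ℝ) : Finset (Fin (k + 1)) → ℝ := fun S => if S = ∅ then 1 else β S

/-- `Φ` does not see the value at `∅`. [this work] -/
theorem phiSet_fixEmpty (β : Finset (Fin (k + 1)) → ℝ) : phiSet (k + 1) (fixEmpty β) = phiSet (k + 1) β :=
  GHBridge.phiSet_congr_nonempty _ _ fun S hS => by rw [fixEmpty, if_neg hS.ne_empty]

/-- The pulled-back family `{T : pb T ∈ 𝒰 ∨ pb T = ∅}`. [this work] -/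
def pbFamily (𝒰 : Finset (Finset (Fin (k + 1)))) : Finset (Finset (Fin (k + 2))) :=
  univ.filter fun T => pb T ∈ 𝒰 ∨ pb T = ∅

/-- Membership in the pulled-back family. [this work] -/
theorem mem_pbFamily {𝒰 : Finset (Finset (Fin (k + 1)))} {T : Finset (Fin (k + 2))} :
    T ∈ pbFamily 𝒰 ↔ pb T ∈ 𝒰 ∨ pb T = ∅ := by
  simp [pbFamily]

/-- The pulled-back family of a union-closed family is union-closed. [this work] -/
theorem pbFamily_unionClosed {𝒰 : Finset (Finset (Fin (k + 1)))} (hUC : ∀ A ∈ 𝒰, ∀ A' ∈ 𝒰, A ∪ A' ∈ 𝒰)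
    (T : Finset (Fin (k + 2))) (hT : T ∈ pbFamily 𝒰) (T' : Finset (Fin (k + 2))) (hT' : T' ∈ pbFamily 𝒰) : T ∪ T' ∈ pbFamily 𝒰 := by
  rw [mem_pbFamily] at hT hT' ⊢
  rw [pb_union]
  rcases hT with hT | hT <;> rcases hT' with hT' | hT'
  · exact Or.inl (hUC _ hT _ hT')
  · rw [hT', union_empty]; exact Or.inl hT
  · rw [hT, empty_union]; exact Or.inl hT'
  · rw [hT, hT', empty_union]; exact Or.inr rfl

/-- The pulled-back family contains `univ` when the family does. [this work] -/
theorem univ_mem_pbFamily {𝒰 : Finset (Finset (Fin (k + 1)))} (htop : univ ∈ 𝒰) : (univ : Finset (Fin (k + 2))) ∈ pbFamily 𝒰 := by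
  rw [mem_pbFamily, pb_univ]; exact Or.inl htop

/-- The indicator of the pulled-back family is the pull-back of the indicator with the value at `∅` set to one. [this work] -/
theorem indicator_pbFamily (𝒰 : Finset (Finset (Fin (k + 1)))) (T : Finset (Fin (k + 2))) :
    (if T ∈ pbFamily 𝒰 then (1 : ℝ) else 0) = fixEmpty (fun S => if S ∈ 𝒰 then (1 : ℝ) else 0) (pb T) := by
  rw [fixEmpty]
  by_cases h0 : pb T = ∅
  · simp only [h0, if_true]
    rw [if_pos (mem_pbFamily.2 (Or.inr h0))]
  · simp only [if_neg h0]
    by_cases hm : pb T ∈ 𝒰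
    · rw [if_pos (mem_pbFamily.2 (Or.inl hm)), if_pos hm]
    · rw [if_neg hm, if_neg (fun h => (mem_pbFamily.1 h).elim hm h0)]

/-- **Downward step**: `(UC-hull)_{k+2} ⇒ (UC-hull)_{k+1}`. [this work] -/
theorem ucHullNonneg_anti (h : GHConjecture.UCHullNonneg (k + 2)) : GHConjecture.UCHullNonneg (k + 1) := by
  rcases Nat.eq_zero_or_pos k with hk | hk
  · subst hk; exact GHSmall.ucHullNonneg_of_le_two (by norm_num)
  intro α _ w 𝒰 hw0 hw1 hUC htop
  -- the pulled-back mixture on `Fin (k+2)`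
  have key := h α w (fun x => pbFamily (𝒰 x)) hw0 hw1 (fun x => pbFamily_unionClosed (hUC x)) fun x => univ_mem_pbFamily (htop x)
  -- its moment function is the pull-back of `fixEmpty β`
  set β : Finset (Fin (k + 1)) → ℝ := fun S => ∑ x, w x * (if S ∈ 𝒰 x then (1 : ℝ) else 0) with hβ
  have hmix : (fun T : Finset (Fin (k + 2)) => ∑ x, w x * (if T ∈ pbFamily (𝒰 x) then (1 : ℝ) else 0)) =
      fun T => fixEmpty β (univ.filter fun i : Fin (k + 1) => Fin.castSucc i ∈ T) := by
    funext T
    show _ = fixEmpty β (pb T)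
    by_cases h0 : pb T = ∅
    · have : ∀ x, w x * (if T ∈ pbFamily (𝒰 x) then (1 : ℝ) else 0) = w x := fun x => by
        rw [if_pos (mem_pbFamily.2 (Or.inr h0)), mul_one]
      rw [fixEmpty, if_pos h0, sum_congr rfl fun x _ => this x, hw1]
    · rw [fixEmpty, if_neg h0]
      refine sum_congr rfl fun x _ => ?_
      rw [indicator_pbFamily, fixEmpty, if_neg h0]
  rw [hmix] at key
  have h0 : fixEmpty β ∅ = 1 := by rw [fixEmpty, if_pos rfl]
  rw [PhiSymmetricLift.phiSet_pullback (fixEmpty β) h0, phiSet_fixEmpty] at key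
  have hk' : (0 : ℝ) < (k : ℝ) := by exact_mod_cast hk
  exact (mul_nonneg_iff_of_pos_left hk').1 key

/-- **`(UC-hull)_k` is monotone**: `(UC-hull)_{k'} ⇒ (UC-hull)_k` for `1 ≤ k ≤ k'`. [this work] -/
theorem ucHullNonneg_of_le {k k' : ℕ} (hk : 1 ≤ k) (hkk' : k ≤ k') (h : GHConjecture.UCHullNonneg k') : GHConjecture.UCHullNonneg k := by
  induction k' with
  | zero => omega
  | succ m ih =>
    rcases Nat.eq_or_lt_of_le hkk' with heq | hlt
    · rw [heq]; exact h
    · obtain ⟨m', rfl⟩ : ∃ m', m = m' + 1 := ⟨m - 1, by omega⟩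
      exact ih (by omega) (ucHullNonneg_anti h)

end PhiCert

end Summit.CriticalPhenomena.PercolationContinuityZ3.Theorems
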